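import Literature.NumberTheory.Rogawski1990.LocalTransferFundamentalLemma     -- ★ `IsLocSmooth` (currency of the road)
import HarnessLib

/-!
# F0 · P3c · line LH6 «StCharTS» — road (D) «DEEP-FL», (D-c) glue «HFHON OF SUM»: the support of the refined test function `f^H₀ = Σ_{j∈s} c_j • g_j` lies in the union of the
# supports of its summands, so a pointwise property (ON the stratum) propagates from the summands; and the support of a shell indicator `𝟙_{K b K}` IS in the shell

Cell `pub/hodgecm-mathlib`, crux H413 = `stmt-HodgeConjecture-24833` (lane `--supports … --as helper`), route HCCMUnconditional; seat LH6-p04 (g3) = road (D) owner of record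
(spec ROAD-D v7 `F0/P3b/LH6-p04/g3/ROAD-D.status.v7.txt`; consumer: the `hfHon` hypothesis of ★ `F0P3cStCharTSTransferChecklist.isLocalDeltaTransfer_doubleCosetSum_of_checklist` and
the `hf` hypothesis of ★ `F0P3cStCharTSOffStratumSum.isLocalDeltaTransfer_of_levi'`).  THEOREMS ONLY, sorry-free, generic (topological groups ∕ spaces); no definition ∕ instance ∕
notation ∕ named fact.  HONEST LABEL: HC_CM is proved only modulo the 7 printed citations (2 remaining: hLiu418 = stmt-HodgeConjecture-24832, h413 = stmt-HodgeConjecture-24833)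
until rung 0 closes; count-neutral plumbing.

THE MATHEMATICS ([Rogawski1990, §4.3 p. 43; §12.7 L. 12.7.3 (proof) p. 195] is where it is consumed; the content is point-set topology): `tsupport (f + g) ⊆ tsupport f ∪ tsupport g`,
`tsupport (c • g) ⊆ tsupport g`, induction over the `Finset`; a double coset `K b K` of a compact open subgroup `K` of a Hausdorff topological group is compact (image of
`K × K`) hence closed, and open, so `tsupport 𝟙_{K b K} ⊆ K b K`.

* `tsupport_finset_sum_smul_subset`, **`forall_mem_tsupport_finset_sum_smul`** (a predicate true on every summand's support is true on the sum's support);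
* `isCompact_doubleCoset`, `isClosed_doubleCoset`, **`tsupport_indicator_doubleCoset_subset`**.

## References
* [Rogawski1990] J. D. Rogawski, *Automorphic Representations of Unitary Groups in Three Variables*, Ann. of Math. Stud. 123 (1990): §4.3 (4.3.1) p. 43; §12.7 Lemma 12.7.3
  (proof) p. 195.
-/

set_option autoImplicit false
-- the mandated namespace has the single-problem summit's repeated segment (`HodgeConjecture.HodgeConjecture`)
set_option linter.dupNamespace false

noncomputable section

open Topology

namespace Summit.HodgeConjecture.HodgeConjecture.Cruxes.H413.F0P3cStCharTSHfHonOfSum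

/-! ## §1 The support of `Σ_j c_j • g_j` -/

section Sum

variable {X : Type*} [TopologicalSpace X] {ι : Type*}

/-- `tsupport (Σ_{j∈s} c_j • g_j) ⊆ ⋃_{j∈s} tsupport g_j`. [cite: Rogawski1990, §4.3 (4.3.1) p. 43] -/
theorem tsupport_finset_sum_smul_subset (s : Finset ι) (cj : ι → ℂ) (g : ι → X → ℂ) :
    tsupport (∑ j ∈ s, cj j • g j) ⊆ ⋃ j ∈ s, tsupport (g j) := by
  classical
  induction s using Finset.induction_on with
  | empty =>
    rw [Finset.sum_empty]
    intro x hx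
    rw [tsupport, Function.support_zero, closure_empty] at hx
    exact absurd hx (Set.notMem_empty x)
  | insert i s hi ih =>
    rw [Finset.sum_insert hi]
    intro x hx
    rcases (tsupport_add (cj i • g i) (∑ j ∈ s, cj j • g j)) hx with h | h
    · exact Set.mem_biUnion (Finset.mem_insert_self i s) (tsupport_smul_subset_right (fun _ => cj i) (g i) h)
    · obtain ⟨j, hj, hxj⟩ := Set.mem_iUnion₂.1 (ih h)
      exact Set.mem_biUnion (Finset.mem_insert_of_mem hj) hxj

/-- **A predicate that holds on every summand's support holds on the support of `Σ_{j∈s} c_j • g_j`** — the shape of the `hfHon` hypothesis of ★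
`isLocalDeltaTransfer_doubleCosetSum_of_checklist` (ON the stratum), fed by «SHELL-ON» per summand. [cite: Rogawski1990, §4.3 (4.3.1) p. 43; §12.7 Lemma 12.7.3 (proof) p. 195] -/
theorem forall_mem_tsupport_finset_sum_smul (s : Finset ι) (cj : ι → ℂ) (g : ι → X → ℂ) (P : X → Prop)
    (h : ∀ j ∈ s, ∀ x ∈ tsupport (g j), P x) : ∀ x ∈ tsupport (∑ j ∈ s, cj j • g j), P x := by
  intro x hx
  obtain ⟨j, hj, hxj⟩ := Set.mem_iUnion₂.1 (tsupport_finset_sum_smul_subset s cj g hx)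
  exact h j hj x hxj

end Sum

/-! ## §2 The support of a shell indicator -/

section Shell

variable {G : Type*} [Group G] [TopologicalSpace G] [IsTopologicalGroup G]

/-- The double coset `K b K'` of compact sets is compact (continuous image of `K × K'`). [cite: Rogawski1990, §4.3 p. 43] -/
theorem isCompact_doubleCoset {K K' : Set G} (hK : IsCompact K) (hK' : IsCompact K') (b : G) : IsCompact (DoubleCoset.doubleCoset b K K') := by
  have himg : DoubleCoset.doubleCoset b K K' = (fun p : G × G => p.1 * b * p.2) '' (K ×ˢ K') := by
    ext x
    simp only [DoubleCoset.mem_doubleCoset, Set.mem_image, Set.mem_prod, Prod.exists]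
    constructor
    · rintro ⟨k, hk, k', hk', rfl⟩; exact ⟨k, k', ⟨hk, hk'⟩, rfl⟩
    · rintro ⟨k, k', ⟨hk, hk'⟩, rfl⟩; exact ⟨k, hk, k', hk', rfl⟩
  rw [himg]
  exact (hK.prod hK').image ((continuous_fst.mul continuous_const).mul continuous_snd)

/-- The double coset `K b K'` of compact sets in a Hausdorff group is closed. [cite: Rogawski1990, §4.3 p. 43] -/
theorem isClosed_doubleCoset [T2Space G] {K K' : Set G} (hK : IsCompact K) (hK' : IsCompact K') (b : G) : IsClosed (DoubleCoset.doubleCoset b K K') :=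
  (isCompact_doubleCoset hK hK' b).isClosed

/-- **`tsupport 𝟙_{K b K'} ⊆ K b K'`** for compact `K, K'` in a Hausdorff group (the `hf` hypothesis of ★ `isLocalDeltaTransfer_of_levi'` for the XIG shell indicator, and the
per-summand support bound feeding «SHELL-ON»). [cite: Rogawski1990, §4.3 (4.3.1) p. 43; §12.7 Lemma 12.7.3 (proof) p. 195] -/
theorem tsupport_indicator_doubleCoset_subset [T2Space G] {K K' : Set G} (hK : IsCompact K) (hK' : IsCompact K') (b : G) {M : Type*} [Zero M] [TopologicalSpace M] (c : M) :
    tsupport ((DoubleCoset.doubleCoset b K K').indicator fun _ => c) ⊆ DoubleCoset.doubleCoset b K K' :=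
  (isClosed_doubleCoset hK hK' b).closure_subset_iff.2 (Set.support_indicator_subset)

/-- The product form: for `K_H = K₂ ×ˢ K₁`-type sets, membership in a double coset projects to the first factor. [cite: Rogawski1990, §4.3 p. 43] -/
theorem fst_mem_doubleCoset_of_mem {A B : Type*} [Group A] [Group B] {K₂ K₂' : Set A} {K₁ K₁' : Set B} {u : A × B} {x : A × B}
    (hx : x ∈ DoubleCoset.doubleCoset u (K₂ ×ˢ K₁) (K₂' ×ˢ K₁')) : x.1 ∈ DoubleCoset.doubleCoset u.1 K₂ K₂' := by
  obtain ⟨k, hk, k', hk', rfl⟩ := DoubleCoset.mem_doubleCoset.1 hx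
  exact DoubleCoset.mem_doubleCoset.2 ⟨k.1, hk.1, k'.1, hk'.1, by rw [Prod.fst_mul, Prod.fst_mul]⟩

end Shell

end Summit.HodgeConjecture.HodgeConjecture.Cruxes.H413.F0P3cStCharTSHfHonOfSum

end
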